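import Summits.QuantumFields.YangMills.Theorems.BalabanUVNodesN16CentreConventionAllDepths
import HarnessLib

/-!
# YM-DAG node N16 (NE3), the located averaging pin (42) ↔ (0.4) — part 18: WHAT GAUGE-EQUIVALENT SCHEMES MUST SHARE — closed Wilson loops of the `k`-fold
# averages are CONJUGATE (equal traces, equal `|W(Γ) − 1|`, equal `pdev`, same small-field radii); THE TRACE TEST for the pin; and [Balaban1985Averaging]
# Prop. 2 (54) for the centre-convention torus (42) `cstep`

Cell `pub-ymgap`, width seat `pub-ymgap-dag-n16-w3` (director-ym №197 ∕ HUMAN RULING D-0149), generation 7; part 18 of the W1b lineage (part 12 p612224 `ExactGaugeDefect`;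
part 14 p616704 `SchemeGaugeEquiv`; part 16 p622848 `schemeGaugeEquiv_step42_cstep` at every depth).  `--kind proof --supports stmt-QuantumFields-20544 --as helper`
(K3⁷; count-neutral; 0 `def`).  `bears_on: R4∕N16`.

THE POINT.  Parts 12∕14∕16∕17 say what the criterion road GIVES (minimisers, leaves, bodies, end numbers transfer between pointwise coarse-gauge-equivalent schemes).
This file says what it COSTS — the necessary conditions any two equivalent schemes satisfy — and turns them into a falsifiable TEST for the (42) ↔ (0.4) pin:
 * §1 under `SchemeGaugeEquiv d s₁ s₂ L N k C`, for every `U ∈ C`: every CLOSED Wilson loop of `avgIterS s₂ k U` is the CONJUGATE by `κ_U(x)` of the same loop of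
   `avgIterS s₁ k U` ([Balaban1985Averaging] (8) for closed contours, `hol_gaugeAct_closed`); hence equal TRACES (`trace_hol_closed_eq`), equal deviations
   `|W(Γ) − 1|` (`norm_hol_closed_sub_one_eq`, (45)), equal `pdev` (`pdev_avgIterS_eq`), the same small-field radii (`smallField_avgIterS_iff`) and unitarity
   (`isUnitaryCfg_avgIterS_iff`).
 * §2 ★ THE TESTS (contrapositives, for cdisprove ∕ the planners): ONE configuration `U ∈ C` and ONE closed loop with `tr W̄_{s₂}(Γ) ≠ tr W̄_{s₁}(Γ)` (or
   `pdev W̄_{s₂} ≠ pdev W̄_{s₁}`) REFUTES `SchemeGaugeEquiv d s₁ s₂ L N k C` (`not_schemeGaugeEquiv_of_trace_ne`, `…_of_pdev_ne`), and against (43) refutes part 12's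
   criterion `ExactGaugeDefect d s L N k C` (`not_exactGaugeDefect_of_trace_ne`, `…_of_pdev_ne`).  For the pin: a single small `U(N)`-field whose (0.4)-average and
   (42)-average have a coarse plaquette with different trace closes the criterion road for (0.4) on every class containing it — the kernel form of
   `W3-PIN-ANATOMY-v4.md` §4 (i) «non-abelian second order is a gauge-INVARIANT discrepancy».
 * §3 THE INSTANCE (part 16, every depth `k`, the (8)-radius regime on `sfClass d L T ε k`): the closed Wilson loops of the centre-convention torus average
   `avgIterS (cstep) k U` and of (43)'s `avgIter L U k` have equal traces and deviations, `pdev` agrees, and ★★ `isUnitaryCfg_smallField_avgIterS_cstep`: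
   [Balaban1985Averaging] Prop. 2 (54) HOLDS VERBATIM FOR THE CENTRE-CONVENTION TORUS (42) — the `k`-fold `cstep`-average of a class member is `U(N)`-valued with all
   plaquettes within `2ε` of `1`, uniformly in `k` (Prop. 2 for (43) BY NAME, part 16 `isUnitaryCfg_smallField_avgIter_of_mem_sfClass`, transported by §1).
 * §4 (the scheme OF RECORD, g0's `step04`): `transfers_of_schemeGaugeEquiv_step04` — coarse-gauge equivalence of `step04` with (43) on N16's small classes would give
   BOTH of g0's displayed pins `Transfer42to04 ∧ Transfer04to42` (part 16); `not_schemeGaugeEquiv_step04_of_trace_ne` — the trace test AT the scheme of record.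
HONEST FRAMING.  [folklore] bookkeeping BY NAME over parts 12∕14∕16, b07's `hol_gaugeAct_closed`, `B7AvgGaugeCovariance.pdev_gaugeAct ∕ norm_conj_sub_one_eq`,
`BlockAverageCurrent.smallField_gaugeAct`, `AveragingDeficitKDatum.isUnitaryCfg_gaugeAct`, Mathlib's `Matrix.trace_mul_cycle`; 0 `def`, 0 `sorry`; NO witness
configuration is constructed here (the tests are implications; the (0.4)-side witness is NOT in the tree); nothing of [Balaban1985Averaging] asserted beyond the
tree's kernel Prop. 2; K3⁷ stubs NOT touched; N16 ∕ NE3 NOT discharged; count-neutral (typed 28∕28 · discharged 5∕27 work-bound, A 5∕28 — unmoved).  One finite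
four-torus programme at fixed `ε` — the Yang–Mills mass gap (Clay) is NOT proved by any of this; R4 closes the conditional finite-𝕋⁴ rung `BalabanLadder.UV` only;
nothing continuum ∕ ℝ⁴ ∕ OS.
-/

set_option autoImplicit false

open scoped BigOperators Matrix Matrix.Norms.L2Operator
open NormedSpace

namespace Summit.QuantumFields.YangMills.BalabanUVNodes.N16SchemeGaugeInvariants

open Literature.MathematicalPhysics.QuantumFieldTheory.Balaban1983to89
open B7Prop1Explicit B7Prop2Explicit
open B7AvgGaugeCovariance (pdev_gaugeAct norm_conj_sub_one_eq)
open T4AveragingDeficitWall (IsUnitaryCfg SmallField)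
open Summit.QuantumFields.BalabanUV.T4Continuum
open MinimalActionRate (sfClass)
open NE3EnergyShapes (IsUnitarySite IsPeriodicSite)
open AveragingDeficitTransport (mem_U1_of_unitary)
open AveragingDeficitKDatum (isUnitaryCfg_gaugeAct gaugeAct_inv_gaugeAct)
open BlockAverageCurrent (smallField_gaugeAct)
open NE7EtaMinimiserGaugeCovariance (isUnitarySite_inv)
open Literature.MathematicalPhysics.QuantumFieldTheory.Balaban1983to89.T4Continuum (T4Family)
open Node00 (MatA ne3NperOfRecord₁₁)
open Summit.QuantumFields.YangMills.BalabanUVNodes.N16AveragingPin (avgIterS step42 avgIterS_step42 step04 Transfer42to04 Transfer04to42)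
open Summit.QuantumFields.YangMills.BalabanUVNodes.N16AveragingTransferOfGaugeDefect (ExactGaugeDefect)
open Summit.QuantumFields.YangMills.BalabanUVNodes.N16CentreConventionTransfer (SchemeGaugeEquiv ExactGaugeDefect.toSchemeGaugeEquiv)
open Summit.QuantumFields.YangMills.BalabanUVNodes.N16CentreConventionAllDepths
  (schemeGaugeEquiv_step42_cstep isUnitaryCfg_smallField_avgIter_of_mem_sfClass h7Body_iff_of_schemeGaugeEquiv)
open Summit.QuantumFields.BalabanUV.T4Continuum.Spine.NE7.TorusB7 (Mat cstep)

noncomputable section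

/-! ## §1 Closed Wilson loops of two equivalent schemes' averages are conjugate; the invariants they share -/

section Invariants

variable {d : ℕ} {n : Type*} [Fintype n] [DecidableEq n]
variable {s s₁ s₂ : ℕ → (Site d → Fin d → (Matrix n n ℂ)ˣ) → (Site d → Fin d → (Matrix n n ℂ)ˣ)}
  {L N k : ℕ} {C : Set (Site d → Fin d → (Matrix n n ℂ)ˣ)}

/-- **CLOSED WILSON LOOPS OF THE TWO `k`-FOLD AVERAGES ARE CONJUGATE**: under `SchemeGaugeEquiv d s₁ s₂ L N k C`, for `U ∈ C` there is a unitary `N`-periodic `κ` with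
`W̄_{s₂}(Γ) = κ(x) · W̄_{s₁}(Γ) · κ(x)⁻¹` for every closed contour `Γ` from `x` ((8) for closed contours, b07's `hol_gaugeAct_closed`). [cite: Balaban1985Averaging, (8) p.18] -/
theorem exists_hol_closed_conj (hE : SchemeGaugeEquiv d s₁ s₂ L N k C) {U : Site d → Fin d → (Matrix n n ℂ)ˣ} (hU : U ∈ C) :
    ∃ κ : Site d → (Matrix n n ℂ)ˣ, IsUnitarySite κ ∧ IsPeriodicSite κ (N : ℤ) ∧
      ∀ (x : Site d) (w : List (Letter d)), disp w = 0 →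
        hol (avgIterS s₂ k U) x w = κ x * hol (avgIterS s₁ k U) x w * (κ x)⁻¹ := by
  obtain ⟨κ, hκ, hκP, h⟩ := hE.defect U hU
  exact ⟨κ, hκ, hκP, fun x w hw => by rw [h, hol_gaugeAct_closed _ _ _ _ hw]⟩

/-- **EQUAL TRACES**: every closed Wilson loop of the two averages has the same trace (`Matrix.trace_mul_cycle`). [folklore] -/
theorem trace_hol_closed_eq (hE : SchemeGaugeEquiv d s₁ s₂ L N k C) {U : Site d → Fin d → (Matrix n n ℂ)ˣ} (hU : U ∈ C)
    (x : Site d) (w : List (Letter d)) (hw : disp w = 0) :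
    Matrix.trace ((hol (avgIterS s₂ k U) x w : (Matrix n n ℂ)ˣ) : Matrix n n ℂ) =
      Matrix.trace ((hol (avgIterS s₁ k U) x w : (Matrix n n ℂ)ˣ) : Matrix n n ℂ) := by
  obtain ⟨κ, -, -, h⟩ := exists_hol_closed_conj hE hU
  rw [h x w hw, Units.val_mul, Units.val_mul, Matrix.trace_mul_cycle, Units.inv_mul, one_mul]

/-- **EQUAL DEVIATIONS `|W(Γ) − 1|`** for every closed loop ((45): conjugation by a unitary is an isometry, `norm_conj_sub_one_eq`). [cite: Balaban1985Averaging, (45) p.24] -/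
theorem norm_hol_closed_sub_one_eq [Nonempty n] (hE : SchemeGaugeEquiv d s₁ s₂ L N k C) {U : Site d → Fin d → (Matrix n n ℂ)ˣ} (hU : U ∈ C)
    (x : Site d) (w : List (Letter d)) (hw : disp w = 0) :
    ‖((hol (avgIterS s₂ k U) x w : (Matrix n n ℂ)ˣ) : Matrix n n ℂ) - 1‖ = ‖((hol (avgIterS s₁ k U) x w : (Matrix n n ℂ)ˣ) : Matrix n n ℂ) - 1‖ := by
  obtain ⟨κ, hκ, -, h⟩ := exists_hol_closed_conj hE hU
  rw [h x w hw]
  exact norm_conj_sub_one_eq (mem_U1_of_unitary (hκ x))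

/-- **EQUAL PLAQUETTE DEVIATIONS**: `pdev (avgIterS s₂ k U) = pdev (avgIterS s₁ k U)` (`pdev_gaugeAct`). [cite: Balaban1985Averaging, (45) p.24] -/
theorem pdev_avgIterS_eq [Nonempty n] (hE : SchemeGaugeEquiv d s₁ s₂ L N k C) {U : Site d → Fin d → (Matrix n n ℂ)ˣ} (hU : U ∈ C) :
    pdev (avgIterS s₂ k U) = pdev (avgIterS s₁ k U) := by
  obtain ⟨κ, hκ, -, h⟩ := hE.defect U hU
  rw [h]
  exact pdev_gaugeAct (fun x => mem_U1_of_unitary (hκ x)) _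

/-- **THE SAME SMALL-FIELD RADII**: `SmallField (avgIterS s₂ k U) a ↔ SmallField (avgIterS s₁ k U) a` (`smallField_gaugeAct` both ways). [folklore] -/
theorem smallField_avgIterS_iff [Nonempty n] (hE : SchemeGaugeEquiv d s₁ s₂ L N k C) {U : Site d → Fin d → (Matrix n n ℂ)ˣ} (hU : U ∈ C) (a : ℝ) :
    SmallField (avgIterS s₂ k U) a ↔ SmallField (avgIterS s₁ k U) a := by
  obtain ⟨κ, hκ, -, h⟩ := hE.defect U hU
  rw [h]
  refine ⟨fun hs => ?_, smallField_gaugeAct hκ⟩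
  have h' := smallField_gaugeAct (u := fun z => (κ z)⁻¹) (isUnitarySite_inv hκ) hs
  rwa [gaugeAct_inv_gaugeAct] at h'

/-- **UNITARITY TRANSFERS**: `avgIterS s₂ k U` is `U(N)`-valued iff `avgIterS s₁ k U` is. [folklore] -/
theorem isUnitaryCfg_avgIterS_iff (hE : SchemeGaugeEquiv d s₁ s₂ L N k C) {U : Site d → Fin d → (Matrix n n ℂ)ˣ} (hU : U ∈ C) :
    IsUnitaryCfg (avgIterS s₂ k U) ↔ IsUnitaryCfg (avgIterS s₁ k U) := by
  obtain ⟨κ, hκ, -, h⟩ := hE.defect U hU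
  rw [h]
  refine ⟨fun hu => ?_, isUnitaryCfg_gaugeAct hκ⟩
  have h' := isUnitaryCfg_gaugeAct (u := fun z => (κ z)⁻¹) (isUnitarySite_inv hκ) hu
  rwa [gaugeAct_inv_gaugeAct] at h'

/-! ## §2 The tests: one loop with the wrong trace refutes the equivalence -/

/-- **★ THE TRACE TEST**: one `U ∈ C` and one closed loop on which the two `k`-fold averages have DIFFERENT TRACES refute `SchemeGaugeEquiv d s₁ s₂ L N k C`. [folklore] -/
theorem not_schemeGaugeEquiv_of_trace_ne {U : Site d → Fin d → (Matrix n n ℂ)ˣ} (hU : U ∈ C) {x : Site d} {w : List (Letter d)} (hw : disp w = 0)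
    (hne : Matrix.trace ((hol (avgIterS s₂ k U) x w : (Matrix n n ℂ)ˣ) : Matrix n n ℂ) ≠
      Matrix.trace ((hol (avgIterS s₁ k U) x w : (Matrix n n ℂ)ˣ) : Matrix n n ℂ)) :
    ¬ SchemeGaugeEquiv d s₁ s₂ L N k C :=
  fun hE => hne (trace_hol_closed_eq hE hU x w hw)

/-- **THE `pdev` TEST**: different plaquette deviations of the two `k`-fold averages of one `U ∈ C` refute the equivalence. [folklore] -/
theorem not_schemeGaugeEquiv_of_pdev_ne [Nonempty n] {U : Site d → Fin d → (Matrix n n ℂ)ˣ} (hU : U ∈ C)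
    (hne : pdev (avgIterS s₂ k U) ≠ pdev (avgIterS s₁ k U)) : ¬ SchemeGaugeEquiv d s₁ s₂ L N k C :=
  fun hE => hne (pdev_avgIterS_eq hE hU)

/-- **★ THE TRACE TEST AGAINST (43)** (part 12's criterion): one `U ∈ C` and one closed loop with `tr W̄_s(Γ) ≠ tr Ū^k(Γ)` (`Ū^k = avgIter L U k`, the tree's (43)) refute
`ExactGaugeDefect d s L N k C` (`1 ≤ L`).  For the pin: ONE small `U(N)`-field whose (0.4)-type and (42)-type coarse plaquettes have different traces closes the
criterion road for (0.4) on every class containing it. [folklore] -/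
theorem not_exactGaugeDefect_of_trace_ne (hL : 1 ≤ L) {U : Site d → Fin d → (Matrix n n ℂ)ˣ} (hU : U ∈ C) {x : Site d} {w : List (Letter d)} (hw : disp w = 0)
    (hne : Matrix.trace ((hol (avgIterS s k U) x w : (Matrix n n ℂ)ˣ) : Matrix n n ℂ) ≠
      Matrix.trace ((hol (avgIter L U k) x w : (Matrix n n ℂ)ˣ) : Matrix n n ℂ)) :
    ¬ ExactGaugeDefect d s L N k C := by
  intro hE
  have h := trace_hol_closed_eq (ExactGaugeDefect.toSchemeGaugeEquiv hL hE) hU x w hw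
  rw [avgIterS_step42] at h
  exact hne h

/-- **THE `pdev` TEST AGAINST (43)**: `pdev W̄_s ≠ pdev Ū^k` for one `U ∈ C` refutes `ExactGaugeDefect d s L N k C`. [folklore] -/
theorem not_exactGaugeDefect_of_pdev_ne [Nonempty n] (hL : 1 ≤ L) {U : Site d → Fin d → (Matrix n n ℂ)ˣ} (hU : U ∈ C)
    (hne : pdev (avgIterS s k U) ≠ pdev (avgIter L U k)) : ¬ ExactGaugeDefect d s L N k C := by
  intro hE
  have h := pdev_avgIterS_eq (ExactGaugeDefect.toSchemeGaugeEquiv hL hE) hU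
  rw [avgIterS_step42] at h
  exact hne h

end Invariants

/-! ## §3 The instance: the centre-convention torus (42) `cstep` at every depth — equal traces, equal `pdev`, and Prop. 2 (54) verbatim -/

section Instance

variable {P : Params} {N : ℕ} [NeZero N]

/-- **EQUAL TRACES OF ALL CLOSED WILSON LOOPS** of the `k`-fold centre-convention torus average and of (43)'s `k`-fold average, for every member of the small-field
class in the (8)-radius regime (`0 ≤ ε`, `16C₀(d)ε ≤ 3`, `1024(d+1)(d+4)L²ε ≤ 1`), every depth `k`. [folklore] -/
theorem trace_hol_closed_avgIterS_cstep_eq (T k : ℕ) {ε : ℝ} (hε0 : 0 ≤ ε) (hε1 : 16 * C0 P.d * ε ≤ 3)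
    (hε2 : 1024 * (P.d + 1) * (P.d + 4) * (P.L : ℝ) ^ 2 * ε ≤ 1) {U : Site P.d → Fin P.d → (Mat N)ˣ} (hU : U ∈ sfClass P.d P.L T ε k)
    (x : Site P.d) (w : List (Letter P.d)) (hw : disp w = 0) :
    Matrix.trace ((hol (avgIterS (fun _ => cstep P N) k U) x w : (Mat N)ˣ) : Mat N) = Matrix.trace ((hol (avgIter P.L U k) x w : (Mat N)ˣ) : Mat N) := by
  have h := trace_hol_closed_eq (schemeGaugeEquiv_step42_cstep (P := P) (N := N) T k hε0 hε1 hε2) hU x w hw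
  rwa [avgIterS_step42] at h

/-- **EQUAL PLAQUETTE DEVIATIONS**: `pdev (avgIterS cstep k U) = pdev (avgIter L U k)` on the class, every depth. [cite: Balaban1985Averaging, (45) p.24] -/
theorem pdev_avgIterS_cstep_eq (T k : ℕ) {ε : ℝ} (hε0 : 0 ≤ ε) (hε1 : 16 * C0 P.d * ε ≤ 3)
    (hε2 : 1024 * (P.d + 1) * (P.d + 4) * (P.L : ℝ) ^ 2 * ε ≤ 1) {U : Site P.d → Fin P.d → (Mat N)ˣ} (hU : U ∈ sfClass P.d P.L T ε k) :
    pdev (avgIterS (fun _ => cstep P N) k U) = pdev (avgIter P.L U k) := by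
  haveI : Nonempty (Fin N) := ⟨0⟩
  have h := pdev_avgIterS_eq (schemeGaugeEquiv_step42_cstep (P := P) (N := N) T k hε0 hε1 hε2) hU
  rwa [avgIterS_step42] at h

/-- **★★ [Balaban1985Averaging] PROPOSITION 2 (54) FOR THE CENTRE-CONVENTION TORUS (42)**: for `U ∈ sfClass d L T ε k` in the (8)-radius regime the `k`-fold
`cstep`-average is `U(N)`-valued with every plaquette variable within `2ε` of `1`, uniformly in `k` — Prop. 2 for (43) BY NAME (part 16
`isUnitaryCfg_smallField_avgIter_of_mem_sfClass` at `j = k`) transported along the defect gauge (§1). [cite: Balaban1985Averaging, Prop. 2 (52)–(54) p.26] -/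
theorem isUnitaryCfg_smallField_avgIterS_cstep (T k : ℕ) {ε : ℝ} (hε0 : 0 ≤ ε) (hε1 : 16 * C0 P.d * ε ≤ 3)
    (hε2 : 1024 * (P.d + 1) * (P.d + 4) * (P.L : ℝ) ^ 2 * ε ≤ 1) {U : Site P.d → Fin P.d → (Mat N)ˣ} (hU : U ∈ sfClass P.d P.L T ε k) :
    IsUnitaryCfg (avgIterS (fun _ => cstep P N) k U) ∧ SmallField (avgIterS (fun _ => cstep P N) k U) (2 * ε) := by
  obtain ⟨hu, hs⟩ := isUnitaryCfg_smallField_avgIter_of_mem_sfClass (P := P) (N := N) hε0 hε1 hε2 hU le_rfl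
  have hE := schemeGaugeEquiv_step42_cstep (P := P) (N := N) T k hε0 hε1 hε2
  refine ⟨(isUnitaryCfg_avgIterS_iff hE hU).2 ?_, (smallField_avgIterS_iff hE hU (2 * ε)).2 ?_⟩
  · rw [avgIterS_step42]; exact hu
  · rw [avgIterS_step42]; exact hs

end Instance

/-! ## §4 The road and its test for the scheme OF RECORD `step04` (g0's (0.4) read on the B7 fold) -/

section Record

variable (N : ℕ) [NeZero N] (F : T4Family)

/-- **THE ROAD**: if the (0.4)-scheme of record `step04 F N` (g0 `N16AveragingPin.step04`) is pointwise coarse-gauge equivalent to (43) (block-lift covariance) at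
every depth `k+1` on N16's classes `sfClass 4 F.L (2L^m) ε (k+1)` for all `0 < ε ≤ ε₁`, then BOTH of g0's displayed pins hold: `Transfer42to04 N F ∧ Transfer04to42 N F`
(part 16 `h7Body_iff_of_schemeGaugeEquiv`).  The hypothesis is asserted for NO family — by `W3-PIN-ANATOMY-v4.md` §4 (i) it is expected to FAIL at non-abelian
second order, which §2's trace test can certify from one witness. [folklore] -/
theorem transfers_of_schemeGaugeEquiv_step04 {ε₁ : ℝ} (hε₁ : 0 < ε₁)
    (hE : ∀ ε : ℝ, 0 < ε → ε ≤ ε₁ → ∀ k : ℕ, SchemeGaugeEquiv 4 (fun _ => step42 F.L) (step04 F N) F.L (ne3NperOfRecord₁₁ F 0 0) (k + 1)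
      (sfClass 4 F.L (ne3NperOfRecord₁₁ F 0 0) ε (k + 1))) :
    Transfer42to04 N F ∧ Transfer04to42 N F :=
  have h := h7Body_iff_of_schemeGaugeEquiv N F (step04 F N) hε₁ hE
  ⟨h.2, h.1⟩

/-- **THE TEST FOR THE SCHEME OF RECORD**: one configuration `U` of a class `C` and one closed loop on which the `k`-fold (0.4)-average of record
`avgIterS (step04 F N) k U` and the tree's (43) `avgIter F.L U k` have DIFFERENT TRACES refute the coarse-gauge equivalence of `step04` with (43) at depth `k`
on `C` — the kernel handle for a disprover of the criterion road (§2 at `s₁ = step42`, g0 `avgIterS_step42`). [folklore] -/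
theorem not_schemeGaugeEquiv_step04_of_trace_ne {k : ℕ} {C : Set ((Fin 4 → ℤ) → Fin 4 → (MatA N)ˣ)} {U : (Fin 4 → ℤ) → Fin 4 → (MatA N)ˣ} (hU : U ∈ C)
    {x : Fin 4 → ℤ} {w : List (Letter 4)} (hw : disp w = 0)
    (hne : Matrix.trace ((hol (avgIterS (step04 F N) k U) x w : (MatA N)ˣ) : MatA N) ≠
      Matrix.trace ((hol (avgIter F.L U k) x w : (MatA N)ˣ) : MatA N)) (T : ℕ) :
    ¬ SchemeGaugeEquiv 4 (fun _ => step42 F.L) (step04 F N) F.L T k C := by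
  intro hE
  have h := trace_hol_closed_eq hE hU x w hw
  rw [avgIterS_step42] at h
  exact hne h

end Record

end

end Summit.QuantumFields.YangMills.BalabanUVNodes.N16SchemeGaugeInvariants
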